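import Literature.Topology.FourManifolds.FishtailChartSwitch
import Literature.Topology.FourManifolds.ParametricLocalDiffeo
import Literature.Topology.FourManifolds.CompactlySupportedDiffeo
import HarnessLib

/-!
# The tube about the vertical segment of Gompf's collar annulus

Infrastructure for the explicit fishtail neighbourhood in the proof of R. Gompf, *More
Cappell–Shaneson spheres are standard*, Algebr. Geom. Topol. 10 (2010), Thm 2.1 / Lemma 2.2 (the
named fact `Literature.Topology.FourManifolds.gompf2010_framedTwist`). Above the surface of
revolution `A` (`FishtailTubeA.lean`) the disc `D` continues as the cylinder `{q₀} × [y₀, y₁] × 𝕊¹_ℓ`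
over the puncture `q₀ = (n_j, 3/4)`. Its tube has to interpolate between two descriptions of the
normal offset `w = a + ib` (rotated with the fibre angle, `w e^{iℓ}`): at the bottom the cap-chart
description `(n, s) = (capN, capS)(d₀ + w e^{iℓ}) = q₀ + Φ(w e^{iℓ})` inherited from `A`, at the
top the affine description `(n, s) = q₀ + (re (w e^{iℓ}), -im (w e^{iℓ}))` needed by the path to
the box. This file builds the interpolating tube and proves that it is a local diffeomorphism and
injective on a uniform neighbourhood of the cylinder:

* `Literature.Topology.FourManifolds.capSwitchMap ε n_j m` — the interpolants
  `E_m = (1 - m) J + m Φ` of `FishtailChartSwitch.lean`, their smoothness on `‖δ‖ < t_j`, their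
  derivative `(1 - m) J + m DΦ(δ)` and its invertibility near `0`
  (`Literature.Topology.FourManifolds.capSwitchEquiv`, a perturbation of `J`), and a radius
  `Literature.Topology.FourManifolds.capSwitchRad` below which everything holds;
* `Literature.Topology.FourManifolds.VertProfile` — the data along the segment: the switch
  parameter `m(y) ∈ [0, 1]`, the frame rotation `θ(y)` and scalings `σ₁(y), σ₂(y) ∈ (0, S]`;
  `Literature.Topology.FourManifolds.VertProfile.frameL` — the frame map
  `w ↦ e^{iθ} (σ₁ re w + i σ₂ im w)` as a continuous linear equivalence;
* `Literature.Topology.FourManifolds.VertProfile.vertMap` — **the tube**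
  `((y, ℓ), w) ↦ ((y, ℓ), q₀ + E_{m(y)} (L_y (w e^{iℓ})))`: smooth on `‖w‖ < r/S`
  (`contDiffOn_vertMap`), injective there (`injOn_vertMap`), and a local diffeomorphism at each
  of its points (`isLocalDiffeomorphAt_vertMap`, by the parametric inverse function theorem
  `isLocalDiffeomorphAt_graph`).

Everything is proved; no named facts.

## References

* R. E. Gompf, *More Cappell–Shaneson spheres are standard*, Algebr. Geom. Topol. 10 (2010)
  1665–1681, proof of Thm 2.1 (the collar joining `F` to `N`) and Lemma 2.2. [GompfAGT2010]
-/

noncomputable section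

open scoped Real ContDiff Topology NNReal Manifold
open Set Function Complex Filter Metric

namespace Literature.Topology.FourManifolds

/-! ### The interpolants `E_m` and their derivative -/

section Switch

variable (ε nj : ℝ)

/-- **The interpolants** `E_m(δ) = (1 - m) J δ + m Φ(δ)` between the derivative `J` of the cap
chart at the puncture and the cap chart `Φ` itself. [folklore] -/
def capSwitchMap (m : ℝ) (δ : ℂ) : ℝ × ℝ := (1 - m) • capJL ε nj δ + m • capPhi ε nj δ

variable {ε nj} (hε : 0 < ε) (hnj : nj ^ 2 < ε ^ 2) (hnj0 : nj < 0)

/-- `d₀ + δ` has negative imaginary part for `‖δ‖ < t_j`. [folklore] -/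
theorem im_capD0_add_neg {δ : ℂ} (hδ : ‖δ‖ < capTj ε nj) : (capD0 ε nj + δ).im < 0 := by
  rw [add_im, capD0_im]
  have h := abs_im_le_norm δ
  have h' := (abs_le.1 (h.trans hδ.le)).2
  have : δ.im < capTj ε nj := lt_of_le_of_lt (le_abs_self _) (lt_of_le_of_lt h hδ)
  linarith

/-- **`Φ` is smooth on the ball `‖δ‖ < t_j`.** [folklore] -/
theorem contDiffAt_capPhi_of_norm_lt {n : ℕ∞} {δ : ℂ}
    (hδ : ‖δ‖ < capTj ε nj) : ContDiffAt ℝ n (capPhi ε nj) δ := by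
  have him := im_capD0_add_neg hδ
  have h0 : capD0 ε nj + δ ≠ 0 := fun h ↦ by rw [h] at him; simp at him
  have hsl : capD0 ε nj + δ ∈ slitPlane := Or.inr (by exact him.ne)
  have htr : ContDiff ℝ n fun δ : ℂ ↦ capD0 ε nj + δ := contDiff_const.add contDiff_id
  have h1 : ContDiffAt ℝ n (fun δ : ℂ ↦ capN ε (capD0 ε nj + δ)) δ :=
    ((contDiffAt_capN ε h0).of_le (by exact_mod_cast le_top)).comp δ htr.contDiffAt
  have h2 : ContDiffAt ℝ n (fun δ : ℂ ↦ capS (capD0 ε nj + δ)) δ :=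
    ((contDiffAt_capS hsl).of_le (by exact_mod_cast le_top)).comp δ htr.contDiffAt
  exact (h1.sub contDiffAt_const).prodMk (h2.sub contDiffAt_const)

/-- **Joint smoothness of `(m, δ) ↦ E_m(δ)` on `‖δ‖ < t_j`.** [folklore] -/
theorem contDiffAt_capSwitchMap {n : ℕ∞} {q : ℝ × ℂ}
    (hq : ‖q.2‖ < capTj ε nj) : ContDiffAt ℝ n (fun q : ℝ × ℂ ↦ capSwitchMap ε nj q.1 q.2) q := by
  unfold capSwitchMap
  have hm : ContDiffAt ℝ n (fun q : ℝ × ℂ ↦ q.1) q := contDiffAt_fst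
  have hJ : ContDiffAt ℝ n (fun q : ℝ × ℂ ↦ capJL ε nj q.2) q :=
    (capJL ε nj).contDiff.contDiffAt.comp q contDiffAt_snd
  have hΦ : ContDiffAt ℝ n (fun q : ℝ × ℂ ↦ capPhi ε nj q.2) q :=
    (contDiffAt_capPhi_of_norm_lt hq).comp q contDiffAt_snd
  exact ((contDiffAt_const.sub hm).smul hJ).add (hm.smul hΦ)

/-- **The derivative of `E_m` in `δ`**: `(1 - m) J + m DΦ(δ)`. [folklore] -/
theorem hasFDerivAt_capSwitchMap (m : ℝ) {δ : ℂ}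
    (hδ : ‖δ‖ < capTj ε nj) :
    HasFDerivAt (capSwitchMap ε nj m) ((1 - m) • capJL ε nj + m • fderiv ℝ (capPhi ε nj) δ) δ := by
  have hΦ : HasFDerivAt (capPhi ε nj) (fderiv ℝ (capPhi ε nj) δ) δ :=
    ((contDiffAt_capPhi_of_norm_lt (n := 1) hδ).differentiableAt one_ne_zero).hasFDerivAt
  exact ((capJL ε nj).hasFDerivAt.const_smul (1 - m)).add (hΦ.const_smul m)

/-- The comparison operator `T(δ) = J⁻¹ ∘ DΦ(δ) : ℂ →L ℂ` (equal to `1` at `δ = 0`). [folklore] -/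
def capSwitchT (δ : ℂ) : ℂ →L[ℝ] ℂ :=
  ((capJ hε hnj hnj0).symm : ℝ × ℝ →L[ℝ] ℂ).comp (fderiv ℝ (capPhi ε nj) δ)

/-- `T(0) = 1`. [folklore] -/
theorem capSwitchT_zero : capSwitchT hε hnj hnj0 0 = 1 := by
  rw [capSwitchT, (hasFDerivAt_capPhi hε hnj hnj0).fderiv]
  ext1 δ
  simp

/-- `T` is continuous at `0`. [folklore] -/
theorem continuousAt_capSwitchT : ContinuousAt (capSwitchT hε hnj hnj0) 0 := by
  have h : ContinuousAt (fderiv ℝ (capPhi ε nj)) 0 :=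
    ((contDiffAt_capPhi hnj hnj0 (ε := ε) (n := 1)).continuousAt_fderiv one_ne_zero)
  exact ((ContinuousLinearMap.compL ℝ ℂ (ℝ × ℝ) ℂ
    ((capJ hε hnj hnj0).symm : ℝ × ℝ →L[ℝ] ℂ)).continuous.continuousAt).comp h

/-- **A radius for the switch**: `r ≤ t_j` such that all `E_m` (`m ∈ [0, 1]`) are injective on
`B(0, r)` and `‖T(δ) - 1‖ < 1/2` for `‖δ‖ < r`. [folklore] -/
theorem exists_capSwitchRad :
    ∃ r > 0, r ≤ capTj ε nj ∧ (∀ m ∈ Icc (0 : ℝ) 1, InjOn (capSwitchMap ε nj m) (ball 0 r)) ∧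
      ∀ δ : ℂ, ‖δ‖ < r → ‖capSwitchT hε hnj hnj0 δ - 1‖ < 1 / 2 := by
  obtain ⟨r₁, hr₁, hinj⟩ := exists_injOn_capSwitch hε hnj hnj0
  have hT : ∀ᶠ δ in 𝓝 (0 : ℂ), ‖capSwitchT hε hnj hnj0 δ - 1‖ < 1 / 2 := by
    have h : ContinuousAt (fun δ ↦ capSwitchT hε hnj hnj0 δ - 1) 0 :=
      (continuousAt_capSwitchT hε hnj hnj0).sub continuousAt_const
    have h0 : ‖capSwitchT hε hnj hnj0 0 - 1‖ < 1 / 2 := by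
      rw [capSwitchT_zero, sub_self, norm_zero]; norm_num
    exact h.norm.eventually (gt_mem_nhds h0)
  obtain ⟨r₂, hr₂, hT'⟩ := Metric.eventually_nhds_iff.1 hT
  refine ⟨min (min r₁ r₂) (capTj ε nj), lt_min (lt_min hr₁ hr₂) (capTj_pos hnj hnj0), min_le_right _ _,
    fun m hm ↦ ?_, fun δ hδ ↦ ?_⟩
  · intro x hx y hy hxy
    have hx' : x ∈ ball (0 : ℂ) r₁ :=
      ball_subset_ball ((min_le_left _ _).trans (min_le_left _ _)) hx
    have hy' : y ∈ ball (0 : ℂ) r₁ :=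
      ball_subset_ball ((min_le_left _ _).trans (min_le_left _ _)) hy
    refine hinj m hm hx' hy' ?_
    simpa [capSwitchMap, capJ_apply, capJL_apply] using hxy
  · refine hT' ?_
    rw [dist_zero_right]
    exact lt_of_lt_of_le hδ ((min_le_left _ _).trans (min_le_right _ _))

/-- **The switch radius** (a choice). [folklore] -/
def capSwitchRad : ℝ := (exists_capSwitchRad hε hnj hnj0).choose

/-- The switch radius is positive. [folklore] -/
theorem capSwitchRad_pos : 0 < capSwitchRad hε hnj hnj0 := (exists_capSwitchRad hε hnj hnj0).choose_spec.1

/-- The switch radius is at most `t_j`. [folklore] -/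
theorem capSwitchRad_le : capSwitchRad hε hnj hnj0 ≤ capTj ε nj :=
  (exists_capSwitchRad hε hnj hnj0).choose_spec.2.1

/-- All interpolants are injective on the switch ball. [folklore] -/
theorem injOn_capSwitchMap {m : ℝ} (hm : m ∈ Icc (0 : ℝ) 1) :
    InjOn (capSwitchMap ε nj m) (ball 0 (capSwitchRad hε hnj hnj0)) :=
  (exists_capSwitchRad hε hnj hnj0).choose_spec.2.2.1 m hm

/-- `‖T(δ) - 1‖ < 1/2` on the switch ball. [folklore] -/
theorem norm_capSwitchT_sub_one_lt {δ : ℂ} (hδ : ‖δ‖ < capSwitchRad hε hnj hnj0) :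
    ‖capSwitchT hε hnj hnj0 δ - 1‖ < 1 / 2 :=
  (exists_capSwitchRad hε hnj hnj0).choose_spec.2.2.2 δ hδ

/-- `‖m (T(δ) - 1)‖ < 1` for `m ∈ [0, 1]` on the switch ball. [folklore] -/
theorem norm_smul_capSwitchT_sub_one_lt {m : ℝ} (hm : m ∈ Icc (0 : ℝ) 1) {δ : ℂ}
    (hδ : ‖δ‖ < capSwitchRad hε hnj hnj0) :
    ‖(1 + m • (capSwitchT hε hnj hnj0 δ - 1)) - ContinuousLinearMap.id ℝ ℂ‖ < 1 := by
  rw [← ContinuousLinearMap.one_def, add_sub_cancel_left, norm_smul, Real.norm_eq_abs, abs_of_nonneg hm.1]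
  have h := norm_capSwitchT_sub_one_lt hε hnj hnj0 hδ
  nlinarith [hm.2, norm_nonneg (capSwitchT hε hnj hnj0 δ - 1)]

/-- **The derivative of `E_m` as a continuous linear equivalence** (on the switch ball, for
`m ∈ [0, 1]`): `J ∘ (1 + m (T(δ) - 1)) = (1 - m) J + m DΦ(δ)`. [folklore] -/
def capSwitchEquiv {m : ℝ} (hm : m ∈ Icc (0 : ℝ) 1) {δ : ℂ} (hδ : ‖δ‖ < capSwitchRad hε hnj hnj0) :
    ℂ ≃L[ℝ] ℝ × ℝ :=
  (ContinuousLinearEquiv.ofNormSubIdLt _ (norm_smul_capSwitchT_sub_one_lt hε hnj hnj0 hm hδ)).trans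
    (capJ hε hnj hnj0)

/-- The underlying map of `capSwitchEquiv` is the derivative of `E_m`. [folklore] -/
theorem coe_capSwitchEquiv {m : ℝ} (hm : m ∈ Icc (0 : ℝ) 1) {δ : ℂ} (hδ : ‖δ‖ < capSwitchRad hε hnj hnj0) :
    (capSwitchEquiv hε hnj hnj0 hm hδ : ℂ →L[ℝ] ℝ × ℝ) =
      (1 - m) • capJL ε nj + m • fderiv ℝ (capPhi ε nj) δ := by
  ext1 w
  show capJ hε hnj hnj0 (w + m • ((capJ hε hnj hnj0).symm (fderiv ℝ (capPhi ε nj) δ w) - w)) =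
    (1 - m) • capJL ε nj w + m • fderiv ℝ (capPhi ε nj) δ w
  rw [map_add, map_smul, map_sub, ContinuousLinearEquiv.apply_symm_apply,
    show (capJ hε hnj hnj0) w = capJL ε nj w from rfl]
  module

/-- **`E_m` has the invertible derivative `capSwitchEquiv` on the switch ball.** [folklore] -/
theorem hasFDerivAt_capSwitchMap_equiv {m : ℝ} (hm : m ∈ Icc (0 : ℝ) 1) {δ : ℂ}
    (hδ : ‖δ‖ < capSwitchRad hε hnj hnj0) :
    HasFDerivAt (capSwitchMap ε nj m) (capSwitchEquiv hε hnj hnj0 hm hδ : ℂ →L[ℝ] ℝ × ℝ) δ := by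
  rw [coe_capSwitchEquiv]
  exact hasFDerivAt_capSwitchMap m (lt_of_lt_of_le hδ (capSwitchRad_le hε hnj hnj0))

/-- At `m = 1` the interpolant is the cap chart. [folklore] -/
theorem capSwitchMap_one (δ : ℂ) : capSwitchMap ε nj 1 δ = capPhi ε nj δ := by
  simp [capSwitchMap]

/-- At `m = 0` the interpolant is the linear map `J`. [folklore] -/
theorem capSwitchMap_zero (δ : ℂ) : capSwitchMap ε nj 0 δ = capJL ε nj δ := by
  simp [capSwitchMap]

end Switch

/-! ### The frame along the segment -/

/-- **The data along the vertical segment**: the switch parameter `m(y) ∈ [0, 1]`, the frame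
rotation `θ(y)` and the frame scalings `0 < σ₁(y), σ₂(y) ≤ S`, all smooth. [folklore] -/
structure VertProfile where
  /-- the switch parameter -/
  m : ℝ → ℝ
  /-- the frame rotation -/
  θ : ℝ → ℝ
  /-- the first scaling -/
  σ₁ : ℝ → ℝ
  /-- the second scaling -/
  σ₂ : ℝ → ℝ
  /-- a bound for the scalings -/
  S : ℝ
  contDiff_m : ContDiff ℝ ∞ m
  contDiff_θ : ContDiff ℝ ∞ θ
  contDiff_σ₁ : ContDiff ℝ ∞ σ₁
  contDiff_σ₂ : ContDiff ℝ ∞ σ₂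
  m_mem : ∀ y, m y ∈ Icc (0 : ℝ) 1
  σ₁_pos : ∀ y, 0 < σ₁ y
  σ₂_pos : ∀ y, 0 < σ₂ y
  σ₁_le : ∀ y, σ₁ y ≤ S
  σ₂_le : ∀ y, σ₂ y ≤ S
  one_le_S : 1 ≤ S

namespace VertProfile

variable (V : VertProfile)

/-- The diagonal scaling `w ↦ σ₁ re w + i σ₂ im w` as a continuous linear map. [folklore] -/
def diagL (y : ℝ) : ℂ →L[ℝ] ℂ :=
  V.σ₁ y • reCLM.smulRight (1 : ℂ) + V.σ₂ y • imCLM.smulRight I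

/-- The value of `diagL`. [folklore] -/
@[simp] theorem diagL_apply (y : ℝ) (w : ℂ) : V.diagL y w = (V.σ₁ y * w.re : ℝ) + (V.σ₂ y * w.im : ℝ) * I := by
  simp [diagL]
  ring

/-- **The frame map** `L_y w = e^{iθ(y)} (σ₁ re w + i σ₂ im w)`. [folklore] -/
def frameL (y : ℝ) : ℂ →L[ℝ] ℂ := exp (V.θ y * I) • V.diagL y

/-- The value of `frameL`. [folklore] -/
theorem frameL_apply (y : ℝ) (w : ℂ) :
    V.frameL y w = exp (V.θ y * I) * ((V.σ₁ y * w.re : ℝ) + (V.σ₂ y * w.im : ℝ) * I) := by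
  simp [frameL, diagL_apply]

/-- The inverse frame map `z ↦ (re u / σ₁ + i im u / σ₂)`, `u = e^{-iθ} z`. [folklore] -/
def frameLinv (y : ℝ) : ℂ →L[ℝ] ℂ :=
  ((V.σ₁ y)⁻¹ • reCLM.smulRight (1 : ℂ) + (V.σ₂ y)⁻¹ • imCLM.smulRight I).comp
    (exp (-(V.θ y * I)) • (1 : ℂ →L[ℝ] ℂ))

/-- The value of `frameLinv`. [folklore] -/
theorem frameLinv_apply (y : ℝ) (z : ℂ) :
    V.frameLinv y z = (((V.σ₁ y)⁻¹ * (exp (-(V.θ y * I)) * z).re : ℝ) : ℂ) +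
      (((V.σ₂ y)⁻¹ * (exp (-(V.θ y * I)) * z).im : ℝ) : ℂ) * I := by
  simp [frameLinv]
  ring

/-- `L⁻¹ ∘ L = id`. [folklore] -/
theorem frameLinv_frameL (y : ℝ) (w : ℂ) : V.frameLinv y (V.frameL y w) = w := by
  have h1 := (V.σ₁_pos y).ne'
  have h2 := (V.σ₂_pos y).ne'
  rw [frameL_apply, frameLinv_apply, ← mul_assoc, exp_neg_mul_exp_mul_I, one_mul]
  apply Complex.ext
  · simp
    field_simp
  · simp
    field_simp

/-- `L ∘ L⁻¹ = id`. [folklore] -/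
theorem frameL_frameLinv (y : ℝ) (z : ℂ) : V.frameL y (V.frameLinv y z) = z := by
  have h1 := (V.σ₁_pos y).ne'
  have h2 := (V.σ₂_pos y).ne'
  rw [frameLinv_apply, frameL_apply]
  set u := exp (-(V.θ y * I)) * z with hu
  have hz : z = exp (V.θ y * I) * u := by rw [hu, ← mul_assoc, exp_mul_I_mul_exp_neg, one_mul]
  rw [hz]
  congr 1
  apply Complex.ext
  · simp
    field_simp
  · simp
    field_simp

/-- **The frame map as a continuous linear equivalence.** [folklore] -/
def frameEquiv (y : ℝ) : ℂ ≃L[ℝ] ℂ :=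
  ContinuousLinearEquiv.equivOfInverse (V.frameL y) (V.frameLinv y) (V.frameLinv_frameL y)
    (V.frameL_frameLinv y)

/-- The underlying map of `frameEquiv`. [folklore] -/
@[simp] theorem coe_frameEquiv (y : ℝ) : (V.frameEquiv y : ℂ →L[ℝ] ℂ) = V.frameL y := rfl

/-- **The frame map is uniformly bounded**: `‖L_y w‖ ≤ S ‖w‖`. [folklore] -/
theorem norm_frameL_le (y : ℝ) (w : ℂ) : ‖V.frameL y w‖ ≤ V.S * ‖w‖ := by
  rw [frameL_apply, norm_mul, norm_exp_ofReal_mul_I, one_mul]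
  have h1 := V.σ₁_pos y
  have h2 := V.σ₂_pos y
  have hS : 0 ≤ V.S := zero_le_one.trans V.one_le_S
  -- `‖(σ₁ a) + (σ₂ b) i‖² = σ₁² a² + σ₂² b² ≤ S² (a² + b²)`
  have hsq : ‖((V.σ₁ y * w.re : ℝ) : ℂ) + ((V.σ₂ y * w.im : ℝ) : ℂ) * I‖ ^ 2 ≤ (V.S * ‖w‖) ^ 2 := by
    rw [Complex.sq_norm, Complex.normSq_apply, mul_pow, Complex.sq_norm, Complex.normSq_apply]
    simp only [add_re, ofReal_re, mul_re, I_re, mul_zero, ofReal_im, I_im, mul_one, sub_self, add_zero,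
      add_im, mul_im, zero_add]
    have ha : (V.σ₁ y * w.re) * (V.σ₁ y * w.re) ≤ V.S * V.S * (w.re * w.re) := by
      have h := mul_self_le_mul_self h1.le (V.σ₁_le y)
      calc (V.σ₁ y * w.re) * (V.σ₁ y * w.re) = (V.σ₁ y * V.σ₁ y) * (w.re * w.re) := by ring
        _ ≤ (V.S * V.S) * (w.re * w.re) := mul_le_mul_of_nonneg_right h (mul_self_nonneg _)
    have hb : (V.σ₂ y * w.im) * (V.σ₂ y * w.im) ≤ V.S * V.S * (w.im * w.im) := by
      have h := mul_self_le_mul_self h2.le (V.σ₂_le y)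
      calc (V.σ₂ y * w.im) * (V.σ₂ y * w.im) = (V.σ₂ y * V.σ₂ y) * (w.im * w.im) := by ring
        _ ≤ (V.S * V.S) * (w.im * w.im) := mul_le_mul_of_nonneg_right h (mul_self_nonneg _)
    nlinarith
  exact (pow_le_pow_iff_left₀ (norm_nonneg _) (by positivity) two_ne_zero).1 hsq

/-- Joint smoothness of `(y, w) ↦ L_y w`. [folklore] -/
theorem contDiff_frameL_uncurry : ContDiff ℝ ∞ fun q : ℝ × ℂ ↦ V.frameL q.1 q.2 := by
  have h : (fun q : ℝ × ℂ ↦ V.frameL q.1 q.2) = fun q ↦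
      exp (V.θ q.1 * I) * ((V.σ₁ q.1 * q.2.re : ℝ) + (V.σ₂ q.1 * q.2.im : ℝ) * I) := by
    funext q; exact V.frameL_apply q.1 q.2
  rw [h]
  have hθ : ContDiff ℝ ∞ fun q : ℝ × ℂ ↦ exp (V.θ q.1 * I) :=
    Complex.contDiff_exp.comp (((ofRealCLM.contDiff.comp (V.contDiff_θ.comp contDiff_fst)).mul contDiff_const))
  have h1 : ContDiff ℝ ∞ fun q : ℝ × ℂ ↦ ((V.σ₁ q.1 * q.2.re : ℝ) : ℂ) :=
    ofRealCLM.contDiff.comp ((V.contDiff_σ₁.comp contDiff_fst).mul (reCLM.contDiff.comp contDiff_snd))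
  have h2 : ContDiff ℝ ∞ fun q : ℝ × ℂ ↦ ((V.σ₂ q.1 * q.2.im : ℝ) : ℂ) :=
    ofRealCLM.contDiff.comp ((V.contDiff_σ₂.comp contDiff_fst).mul (imCLM.contDiff.comp contDiff_snd))
  exact hθ.mul (h1.add (h2.mul contDiff_const))

end VertProfile

/-! ### The tube about the vertical segment -/

section Tube

variable {ε nj : ℝ} (hε : 0 < ε) (hnj : nj ^ 2 < ε ^ 2) (hnj0 : nj < 0) (V : VertProfile)

/-- Multiplication by a nonzero complex number as a real continuous linear equivalence. [folklore] -/
def mulEquiv {c : ℂ} (hc : c ≠ 0) : ℂ ≃L[ℝ] ℂ :=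
  ContinuousLinearEquiv.equivOfInverse (c • (1 : ℂ →L[ℝ] ℂ)) (c⁻¹ • (1 : ℂ →L[ℝ] ℂ))
    (fun x ↦ by simp [hc]) (fun x ↦ by simp [hc])

/-- The underlying map of `mulEquiv`. [folklore] -/
@[simp] theorem coe_mulEquiv {c : ℂ} (hc : c ≠ 0) : (mulEquiv hc : ℂ →L[ℝ] ℂ) = c • (1 : ℂ →L[ℝ] ℂ) := rfl

variable (ε nj) in
/-- **The `(n, s)`-coordinates of the tube point**: `q₀ + E_{m(y)}(L_y(w e^{iℓ}))`,
`q₀ = (n_j, 3/4)`. [folklore] -/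
def vertCore (y ℓ : ℝ) (w : ℂ) : ℝ × ℝ :=
  (nj, 3 / 4) + capSwitchMap ε nj (V.m y) (V.frameL y (w * exp (ℓ * I)))

variable (ε nj) in
/-- **The tube about the vertical segment** in graph form: `((y, ℓ), w) ↦ ((y, ℓ), (n, s))`. [cite: GompfAGT2010, Thm 2.1 (proof: the collar [1,2] × ∂F joining F to N)] -/
def vertMap (q : (ℝ × ℝ) × ℂ) : (ℝ × ℝ) × (ℝ × ℝ) := (q.1, vertCore ε nj V q.1.1 q.1.2 q.2)

/-- The argument of the switch has norm `≤ S ‖w‖`. [folklore] -/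
theorem norm_frameL_mul_exp_le (y ℓ : ℝ) (w : ℂ) : ‖V.frameL y (w * exp (ℓ * I))‖ ≤ V.S * ‖w‖ := by
  have h := V.norm_frameL_le y (w * exp (ℓ * I))
  rwa [norm_mul, norm_exp_ofReal_mul_I, mul_one] at h

/-- The tube domain `‖w‖ < r / S` is open. [folklore] -/
theorem isOpen_vertDom (r : ℝ) : IsOpen {q : (ℝ × ℝ) × ℂ | ‖q.2‖ < r / V.S} :=
  isOpen_lt (continuous_norm.comp continuous_snd) continuous_const

/-- On the tube domain the argument of the switch lies in the switch ball. [folklore] -/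
theorem norm_arg_lt {r : ℝ} {y ℓ : ℝ} {w : ℂ} (hw : ‖w‖ < r / V.S) :
    ‖V.frameL y (w * exp (ℓ * I))‖ < r := by
  have hS : 0 < V.S := lt_of_lt_of_le zero_lt_one V.one_le_S
  have h := norm_frameL_mul_exp_le V y ℓ w
  calc ‖V.frameL y (w * exp (ℓ * I))‖ ≤ V.S * ‖w‖ := h
    _ < V.S * (r / V.S) := by gcongr
    _ = r := mul_div_cancel₀ r hS.ne'

/-- **The tube is smooth on `‖w‖ < t_j / S`.** [folklore] -/
theorem contDiffOn_vertMap :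
    ContDiffOn ℝ ∞ (vertMap ε nj V) {q : (ℝ × ℝ) × ℂ | ‖q.2‖ < capTj ε nj / V.S} := by
  intro q hq
  refine ContDiffAt.contDiffWithinAt ?_
  unfold vertMap vertCore
  refine contDiffAt_fst.prodMk (contDiffAt_const.add ?_)
  have harg : ContDiffAt ℝ ∞ (fun q : (ℝ × ℝ) × ℂ ↦ V.frameL q.1.1 (q.2 * exp (q.1.2 * I))) q := by
    have h1 : ContDiff ℝ ∞ fun q : (ℝ × ℝ) × ℂ ↦ q.2 * exp (q.1.2 * I) :=
      contDiff_snd.mul (Complex.contDiff_exp.comp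
        ((ofRealCLM.contDiff.comp (contDiff_snd.comp contDiff_fst)).mul contDiff_const))
    exact V.contDiff_frameL_uncurry.contDiffAt.comp q ((contDiff_fst.comp contDiff_fst).prodMk h1).contDiffAt
  have hm : ContDiffAt ℝ ∞ (fun q : (ℝ × ℝ) × ℂ ↦ V.m q.1.1) q :=
    (V.contDiff_m.comp (contDiff_fst.comp contDiff_fst)).contDiffAt
  have hpair : ContDiffAt ℝ ∞ (fun q : (ℝ × ℝ) × ℂ ↦ (V.m q.1.1, V.frameL q.1.1 (q.2 * exp (q.1.2 * I)))) q :=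
    hm.prodMk harg
  have hsw : ContDiffAt ℝ ∞ (fun p : ℝ × ℂ ↦ capSwitchMap ε nj p.1 p.2)
      (V.m q.1.1, V.frameL q.1.1 (q.2 * exp (q.1.2 * I))) :=
    contDiffAt_capSwitchMap (norm_arg_lt V hq)
  exact hsw.comp q hpair

/-- **The tube is injective on `‖w‖ < r_switch / S`.** [folklore] -/
theorem injOn_vertMap :
    InjOn (vertMap ε nj V) {q : (ℝ × ℝ) × ℂ | ‖q.2‖ < capSwitchRad hε hnj hnj0 / V.S} := by
  rintro ⟨⟨y, ℓ⟩, w⟩ hq ⟨⟨y', ℓ'⟩, w'⟩ hq' h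
  simp only [vertMap, Prod.mk.injEq] at h
  obtain ⟨⟨rfl, rfl⟩, hc⟩ := h
  simp only [vertCore, add_right_inj] at hc
  have h1 := injOn_capSwitchMap hε hnj hnj0 (V.m_mem y) (mem_ball_zero_iff.2 (norm_arg_lt V hq))
    (mem_ball_zero_iff.2 (norm_arg_lt V hq')) hc
  have h2 : w * exp (ℓ * I) = w' * exp (ℓ * I) := by
    have := congrArg (V.frameLinv y) h1
    rwa [V.frameLinv_frameL, V.frameLinv_frameL] at this
  have h3 : w = w' := mul_right_cancel₀ (exp_ne_zero _) h2
  rw [h3]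

/-- **The tube is a local diffeomorphism** at every point of `‖w‖ < r_switch / S` (parametric
inverse function theorem: the partial derivative in `w` is `E′_{m(y)} ∘ L_y ∘ (· e^{iℓ})`). [folklore] -/
theorem isLocalDiffeomorphAt_vertMap {q : (ℝ × ℝ) × ℂ} (hq : ‖q.2‖ < capSwitchRad hε hnj hnj0 / V.S) :
    IsLocalDiffeomorphAt 𝓘(ℝ, (ℝ × ℝ) × ℂ) 𝓘(ℝ, (ℝ × ℝ) × (ℝ × ℝ)) ∞ (vertMap ε nj V) q := by
  have hS : 0 < V.S := lt_of_lt_of_le zero_lt_one V.one_le_S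
  -- the domain
  have hsub : {q : (ℝ × ℝ) × ℂ | ‖q.2‖ < capSwitchRad hε hnj hnj0 / V.S} ⊆
      {q : (ℝ × ℝ) × ℂ | ‖q.2‖ < capTj ε nj / V.S} := fun q hq ↦
    lt_of_lt_of_le hq (div_le_div_of_nonneg_right (capSwitchRad_le hε hnj hnj0) hS.le)
  have hf : ContDiffOn ℝ ∞ (fun q : (ℝ × ℝ) × ℂ ↦ vertCore ε nj V q.1.1 q.1.2 q.2)
      {q : (ℝ × ℝ) × ℂ | ‖q.2‖ < capSwitchRad hε hnj hnj0 / V.S} :=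
    (contDiff_snd.comp_contDiffOn (contDiffOn_vertMap V)).mono hsub
  -- the partial derivative in `w`
  set y := q.1.1
  set ℓ := q.1.2
  set w := q.2
  set δ := V.frameL y (w * exp (ℓ * I)) with hδ
  have hδr : ‖δ‖ < capSwitchRad hε hnj hnj0 := norm_arg_lt V hq
  set B : ℂ ≃L[ℝ] ℝ × ℝ :=
    ((mulEquiv (exp_ne_zero (ℓ * I))).trans (V.frameEquiv y)).trans
      (capSwitchEquiv hε hnj hnj0 (V.m_mem y) hδr) with hB
  have hBd : HasFDerivAt (fun w' : ℂ ↦ vertCore ε nj V y ℓ w') (B : ℂ →L[ℝ] ℝ × ℝ) w := by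
    have h1 : HasFDerivAt (fun w' : ℂ ↦ w' * exp (ℓ * I)) (exp (ℓ * I) • (1 : ℂ →L[ℝ] ℂ)) w :=
      (hasFDerivAt_id (𝕜 := ℝ) w).mul_const (exp (ℓ * I))
    have h2 : HasFDerivAt (fun w' : ℂ ↦ V.frameL y (w' * exp (ℓ * I)))
        ((V.frameL y).comp (exp (ℓ * I) • (1 : ℂ →L[ℝ] ℂ))) w :=
      (V.frameL y).hasFDerivAt.comp w h1
    have h3 := (hasFDerivAt_capSwitchMap_equiv hε hnj hnj0 (V.m_mem y) hδr).comp w h2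
    have h4 : HasFDerivAt (fun w' : ℂ ↦ vertCore ε nj V y ℓ w')
        (((capSwitchEquiv hε hnj hnj0 (V.m_mem y) hδr : ℂ →L[ℝ] ℝ × ℝ).comp
          ((V.frameL y).comp (exp (ℓ * I) • (1 : ℂ →L[ℝ] ℂ))))) w :=
      h3.const_add _
    refine h4.congr_fderiv ?_
    rw [hB]
    rfl
  exact isLocalDiffeomorphAt_graph (isOpen_vertDom V _) hq hf (by exact_mod_cast le_top) B hBd

/-- **Bottom of the segment**: where `m = 1`, `θ = 0`, `σ₁ = σ₂ = 1` the tube is the cap-chart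
tube `(n, s) = (capN, capS)(d₀ + w e^{iℓ})`. [folklore] -/
theorem vertCore_of_bottom {y : ℝ} (hm : V.m y = 1) (hθ : V.θ y = 0) (h1 : V.σ₁ y = 1) (h2 : V.σ₂ y = 1)
    (ℓ : ℝ) (w : ℂ) :
    vertCore ε nj V y ℓ w = (capN ε (capD0 ε nj + w * exp (ℓ * I)), capS (capD0 ε nj + w * exp (ℓ * I))) := by
  have hL : V.frameL y (w * exp (ℓ * I)) = w * exp (ℓ * I) := by
    set w' := w * exp (ℓ * I)
    rw [V.frameL_apply, hθ, h1, h2]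
    simp only [ofReal_zero, zero_mul, Complex.exp_zero, one_mul]
    exact re_add_im w'
  rw [vertCore, hm, capSwitchMap_one, hL, capPhi]
  ext <;> simp

/-- **Top of the segment**: where `m = 0` the tube is affine,
`(n, s) = q₀ + J (L_y (w e^{iℓ}))`. [folklore] -/
theorem vertCore_of_top {y : ℝ} (hm : V.m y = 0) (ℓ : ℝ) (w : ℂ) :
    vertCore ε nj V y ℓ w = (nj, 3 / 4) + capJL ε nj (V.frameL y (w * exp (ℓ * I))) := by
  rw [vertCore, hm, capSwitchMap_zero]

end Tube

end Literature.Topology.FourManifolds
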